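import Summits.AnomalousDissipation.AnomalousDissipation.Theorems.SawtoothPulseCascadeK1LocalisedCascadeClassBlocksCTGV
import Summits.AnomalousDissipation.AnomalousDissipation.Theorems.SawtoothPulseCascadeK1LocalisedCascadeClassBlocksCT
import Summits.AnomalousDissipation.AnomalousDissipation.Theorems.SawtoothPulseCascadeK1LocalisedCascadeBlockJunkCT

/-!
# K1loc — helper: AN H-CLASS STEP SUMMED OVER FIBRE BLOCKS IN ALL-ORDERS CORNER-TRACE GRADE («CT-GEO» class, H twin of `…ClassBlocksCTGV`)

Helper file of the prover lane on the crux `K1LocalisedCascade` (stmt-AnomalousDissipation-19491), route `SawtoothPulseCascade`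
(S-D fibre ledger, corner-trace track; finding F-p1g9-1, memo v15).  `…ClassBlocksCTE.tsum_class_{v,h}step_blocks_ctE_le` with the
block brick replaced by `…ClassBlockCTG.sum_block_iterate_{v,h}step_ctg_le`: blocks `[Λ_m, Λ_{m+1})`, `m < M_b`, each with a BOX
window `|k_window| ≤ K_m`, box trapezoid (plateau `L_m`, ramps `R_m`), gap `K_m + (L_m+R_m) + 1 ≤ Λ_mG`; per-block junk
`(1+ε)(N²/π²)τ_m·r*_m + c₂,m·Φ_m` (trace scalar `τ_m` at the near edge of the bottom fibre's packet, order-`p` remainder `c₂,m`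
against the block's fibre energy `Φ_m`, `Σ_mΦ_m ≤ ½`), rounding `(πΛ_{m+1}Gε/N)²Φ_m + 8Mδ_jr*_m/π`, Minkowski across the blocks:
  `Σ'[q]‖𝓕a_{j+1}‖² ≤ (√(A + β*/2) + √(ρ*/2 + Z) + √(Σ'[P]‖𝓕b_j‖²))² + far tail²`
with `Σ_m (1+ε)(N²/π²)τ_m r*_m ≤ A`, `c₂,m ≤ β*`, `(πΛ_{m+1}Gε/N)² ≤ ρ*`, `Σ_m 8Mδ_jr*_m/π ≤ Z`.
No definitions; nothing about the crux. [cite: Grafakos2014, Prop. 3.1.2 (5), Prop. 3.2.7 (3)] [problem: turb]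
-/

-- `Summit.<Summit>.<Problem>`: single-conjunct summit, the duplicate namespace segment is deliberate.
set_option linter.dupNamespace false

noncomputable section

namespace Summit.AnomalousDissipation.AnomalousDissipation.Theorems.SawtoothPulseCascade.K1Window

open MeasureTheory Set Filter Topology UnitAddTorus Function Complex Metric
open scoped Real ENNReal
open Literature.Analysis Literature.Analysis.FunctionSpaces Literature.Analysis.FunctionSpaces.Torus Literature.Analysis.FluidPDE
open Literature.Analysis.FluidPDE.ShearStage
open Literature.Analysis.FluidPDE.SawtoothCascade Literature.Analysis.FluidPDE.SawtoothCascade.CascadeParams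
open Summit.AnomalousDissipation.AnomalousDissipation.Theorems.SawtoothPulseCascade.K1Start
open Summit.AnomalousDissipation.AnomalousDissipation.Theorems.SawtoothPulseCascade.K1Flat
open Summit.AnomalousDissipation.AnomalousDissipation.Theorems.SawtoothPulseCascade.K1Ledger.From


section Cascade

variable (P : CascadeParams)

set_option maxHeartbeats 800000 in
/-- **AN H-CLASS OF `b_j` SUMMED OVER FIBRE BLOCKS, CT-GEO GRADE, AGGREGATE TRACKED ENERGY** (fibres `k₀`, sources in `k₁`). [cite: Grafakos2014, Prop. 3.1.2 (5), Prop. 3.2.7 (3)] -/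
theorem tsum_class_hstep_blocks_ctg_le {G : ℕ} (hγ : P.γ = G) (hδ₀ : 0 < P.δ₀) (hd : 0 < P.d) (hN₀ : 1 ≤ P.N₀)
    (hρN : 1 ≤ P.ρN) (a b : ℕ → UnitAddTorus (Fin 2) → ℝ) (has : ∀ j, IsSmooth (a j)) (h0 : a 0 = datum)
    (hb : ∀ j, b j = a j ∘ shearMap 0 1 (amp ⟨P.U j, P.U_periodic j, P.contDiff_U (P.δ_pos hδ₀ hd j)⟩ P.γ))
    (hab : ∀ j, a (j + 1) = b j ∘ shearMap 1 0 (amp ⟨P.U j, P.U_periodic j, P.contDiff_U (P.δ_pos hδ₀ hd j)⟩ P.γ))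
    (j : ℕ) (q : (Fin 2 → ℤ) → Prop) [DecidablePred q]
    (Λb : ℕ → ℕ) (hΛb : Monotone Λb) (hΛ0 : 1 ≤ Λb 0) (Mb : ℕ)
    (W : Finset (Fin 2 → ℤ)) (hqW : ∀ k, q k → |k 0| < (Λb Mb : ℤ) → k ∈ W)
    (hW : ∀ k ∈ W, (Λb 0 : ℤ) ≤ |k 0| ∧ |k 0| < (Λb Mb : ℤ))
    (L R K : ℕ → ℕ) (hR : ∀ m, 0 < R m) (hLR : ∀ m, 2 ≤ L m + R m)
    (hWK : ∀ m, ∀ k ∈ W, (Λb m : ℤ) ≤ |k 0| → |k 0| < (Λb (m + 1) : ℤ) → |k 1| ≤ (K m : ℤ))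
    (hgap : ∀ m ∈ Finset.range Mb, K m + (L m + R m) + 1 ≤ Λb m * G)
    (hWsym : ∀ k ∈ W, Function.update k 0 (-k 0) ∈ W)
    {po : ℕ} (hp : 1 ≤ po) {εg M ε : ℝ} (hεg : 0 < εg) (hM : 1 ≤ M) (hMδ : M * P.δ j < π / 2) (hε : Real.exp (-(M ^ 2 / 2)) ≤ ε)
    (Pf : (Fin 2 → ℤ) → Prop) [DecidablePred Pf]
    (hPf : ∀ m, ∀ k : Fin 2 → ℤ, (Λb m : ℤ) ≤ |k 0| → |k 0| < (Λb (m + 1) : ℤ) → (L m : ℤ) < |k 1| → Pf k)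
    {A βs ρs Z : ℝ} (hβs : 0 ≤ βs) (hρs : 0 ≤ ρs)
    (hA : ∑ m ∈ Finset.range Mb, (1 + εg) * ((P.N j : ℝ) ^ 2 / π ^ 2) *
              (8 * ((Λb m : ℝ) * G - (((L m + R m : ℕ) : ℝ) - 1)) ^ 2 / (((Λb m : ℝ) * G - (((L m + R m : ℕ) : ℝ) - 1)) ^ 2 - (K m : ℝ) ^ 2) ^ 2 +
                8 * ((K m : ℝ) + 1 / 2) / (P.N j * (((Λb m : ℝ) * G - (((L m + R m : ℕ) : ℝ) - 1)) ^ 2 - ((K m : ℝ) + 1 / 2) ^ 2))) *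
              ((Real.sqrt ((2 * L m + R m : ℕ) * R m) / R m * 1) ^ 2 / 2 + (Real.sqrt ((2 * L m + R m : ℕ) * R m) / R m * 1) ^ 2 / 2) ≤ A)
    (hβ : ∀ m ∈ Finset.range Mb, (1 + εg⁻¹) * ((P.N j : ℝ) ^ 2 / π ^ 2) * (4 / (((Λb m * G - K m - (L m + R m) : ℕ) : ℝ)) ^ 2 *
              (1 / ((((Λb m * G - K m - (L m + R m) : ℕ) : ℝ)) + ((L m + R m : ℕ) : ℝ)) ^ (2 * po) +
                1 / (P.N j * ((((Λb m * G - K m - (L m + R m) : ℕ) : ℝ)) + ((L m + R m : ℕ) : ℝ)) ^ (2 * po - 1)))) *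
              ((2 * ((L m + R m : ℕ) : ℝ) / P.N j + 1) * ((L m + R m : ℕ) : ℝ) ^ (2 * po)) ≤ βs)
    (hρ : ∀ m ∈ Finset.range Mb, (π * ((Λb (m + 1) * G : ℕ) : ℝ) * ε / P.N j) ^ 2 ≤ ρs)
    (hZ : ∑ m ∈ Finset.range Mb, 8 * M * P.δ j / π * ((Real.sqrt ((2 * L m + R m : ℕ) * R m) / R m * 1) ^ 2 / 2 + (Real.sqrt ((2 * L m + R m : ℕ) * R m) / R m * 1) ^ 2 / 2) ≤ Z) :
    ∑' k : Fin 2 → ℤ, (if q k then (1 : ℝ) else 0) * ‖mFourierCoeff (fun x => (b j x : ℂ)) k‖ ^ 2 ≤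
      (Real.sqrt (A + βs / 2) + Real.sqrt (ρs / 2 + Z) +
          Real.sqrt (∑' k : Fin 2 → ℤ, (if Pf k then (1 : ℝ) else 0) * ‖mFourierCoeff (fun x => (a j x : ℂ)) k‖ ^ 2)) ^ 2 +
        ((1 + P.γ) ^ (2 * j) / Λb Mb) ^ 2 := by
  classical
  have hγ0 : 0 ≤ P.γ := by rw [hγ]; exact Nat.cast_nonneg G
  have hbs : IsSmooth (b j) := isSmooth_b P hδ₀ hd a b has hb j
  have hbc : Continuous fun x => (b j x : ℂ) := Complex.continuous_ofReal.comp hbs.continuous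
  set ca : (Fin 2 → ℤ) → ℝ := fun k => ‖mFourierCoeff (fun x => (b j x : ℂ)) k‖ ^ 2 with hca
  set cb : (Fin 2 → ℤ) → ℝ := fun k => ‖mFourierCoeff (fun x => (a j x : ℂ)) k‖ ^ 2 with hcb
  have hcas : Summable ca := (hasSum_sq_mFourierCoeff_of_continuous hbc).summable
  have hcbs : Summable cb :=
    (hasSum_sq_mFourierCoeff_of_continuous (Complex.continuous_ofReal.comp (has j).continuous)).summable
  have hca0 : ∀ k, 0 ≤ ca k := fun k => sq_nonneg _
  have hcb0 : ∀ k, 0 ≤ cb k := fun k => sq_nonneg _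
  have hIb : ∀ (r : (Fin 2 → ℤ) → Prop) [DecidablePred r], Summable fun k => (if r k then (1 : ℝ) else 0) * cb k := by
    intro r _
    refine Summable.of_nonneg_of_le (fun k => mul_nonneg (by split_ifs <;> norm_num) (hcb0 k)) (fun k => ?_) hcbs
    exact mul_le_of_le_one_left (hcb0 k) (by split_ifs <;> norm_num)
  have hMb1 : 1 ≤ Λb Mb := hΛ0.trans (hΛb (Nat.zero_le Mb))
  have hMb0 : (0 : ℝ) < Λb Mb := by exact_mod_cast hMb1
  have h1 := tsum_indicator_le_sum_add_far_of_lt hcas hca0 q 0 (Λb Mb) W hqW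
  have hfar := tsum_far_halfIterate_fst_le P hγ0 hδ₀ hd a b has h0 hb hab j (R := (Λb Mb : ℝ)) hMb0
  -- Step 2: the window along the blocks
  have hΛz : Monotone (fun m => (Λb m : ℤ)) := fun m n h => by
    show (Λb m : ℤ) ≤ (Λb n : ℤ)
    exact_mod_cast hΛb h
  have hWeq : W.filter (fun k => (Λb 0 : ℤ) ≤ |k 0| ∧ |k 0| < (Λb Mb : ℤ)) = W :=
    Finset.filter_true_of_mem fun k hk => hW k hk
  have h2 : ∑ k ∈ W, ca k =
      ∑ m ∈ Finset.range Mb, ∑ k ∈ W.filter (fun k => (Λb m : ℤ) ≤ |k 0| ∧ |k 0| < (Λb (m + 1) : ℤ)), ca k := by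
    conv_lhs => rw [← hWeq]
    exact sum_filter_blocks_eq W ca (fun k : Fin 2 → ℤ => |k 0|) hΛz Mb
  -- Step 3: the fibre energies of the blocks and their total
  set Qs : ℕ := ∑ m ∈ Finset.range Mb, (L m + R m) with hQs
  have hLQ : ∀ m ∈ Finset.range Mb, L m + R m ≤ Qs := fun m hm =>
    Finset.single_le_sum (f := fun m => L m + R m) (fun _ _ => Nat.zero_le _) hm
  set ψ : ℤ → ℝ := fun n => ∑ l ∈ Finset.Icc (-(Qs : ℤ)) Qs, ‖mFourierCoeff (fun x => (a j x : ℂ)) ![n, l]‖ ^ 2 with hψ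
  have hψ0 : ∀ n, 0 ≤ ψ n := fun n => Finset.sum_nonneg fun l _ => sq_nonneg _
  set Φ : ℕ → ℝ := fun m => ∑ n ∈ (W.filter (fun k => (Λb m : ℤ) ≤ |k 0| ∧ |k 0| < (Λb (m + 1) : ℤ))).image (fun k => k 0), ψ n with hΦ
  have hΦ0 : ∀ m, 0 ≤ Φ m := fun m => Finset.sum_nonneg fun n _ => hψ0 n
  have hEm : ∀ m ∈ Finset.range Mb,
      ∑ n ∈ (W.filter (fun k => (Λb m : ℤ) ≤ |k 0| ∧ |k 0| < (Λb (m + 1) : ℤ))).image (fun k => k 0),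
        ∑ l ∈ Finset.Icc (-((L m + R m : ℕ) : ℤ)) (L m + R m : ℕ), ‖mFourierCoeff (fun x => (a j x : ℂ)) ![n, l]‖ ^ 2 ≤
        Φ m := by
    intro m hm
    refine Finset.sum_le_sum fun n _ => ?_
    refine Finset.sum_le_sum_of_subset_of_nonneg (Finset.Icc_subset_Icc ?_ ?_) fun l _ _ => sq_nonneg _
    · exact neg_le_neg (by exact_mod_cast hLQ m hm)
    · exact_mod_cast hLQ m hm
  have hΦsum : ∑ m ∈ Finset.range Mb, Φ m ≤ 1 / 2 := by
    set F : Finset ℤ := W.image (fun k => k 0) with hF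
    have hfilt : ∀ m, (W.filter (fun k => (Λb m : ℤ) ≤ |k 0| ∧ |k 0| < (Λb (m + 1) : ℤ))).image (fun k => k 0) =
        F.filter (fun n => (Λb m : ℤ) ≤ |n| ∧ |n| < (Λb (m + 1) : ℤ)) := fun m => by
      rw [hF, Finset.filter_image]
    have e1 : ∑ m ∈ Finset.range Mb, Φ m =
        ∑ m ∈ Finset.range Mb, ∑ n ∈ F.filter (fun n => (Λb m : ℤ) ≤ |n| ∧ |n| < (Λb (m + 1) : ℤ)), ψ n :=
      Finset.sum_congr rfl fun m _ => by simp only [hΦ, hfilt]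
    rw [e1, ← sum_filter_blocks_eq F ψ (fun n : ℤ => |n|) hΛz Mb]
    calc ∑ n ∈ F.filter (fun n => (Λb 0 : ℤ) ≤ |n| ∧ |n| < (Λb Mb : ℤ)), ψ n ≤ ∑ n ∈ F, ψ n :=
          Finset.sum_le_sum_of_subset_of_nonneg (Finset.filter_subset _ _) fun n _ _ => hψ0 n
      _ ≤ 1 / 2 := sum_sum_sq_norm_mFourierCoeff_iterate_h_le_half P hδ₀ hd a b has h0 hb hab j F (Finset.Icc (-(Qs : ℤ)) Qs)
  set u : ℕ → ℝ := fun m =>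
    Real.sqrt ((1 + εg) * ((P.N j : ℝ) ^ 2 / π ^ 2) *
              (8 * ((Λb m : ℝ) * G - (((L m + R m : ℕ) : ℝ) - 1)) ^ 2 / (((Λb m : ℝ) * G - (((L m + R m : ℕ) : ℝ) - 1)) ^ 2 - (K m : ℝ) ^ 2) ^ 2 +
                8 * ((K m : ℝ) + 1 / 2) / (P.N j * (((Λb m : ℝ) * G - (((L m + R m : ℕ) : ℝ) - 1)) ^ 2 - ((K m : ℝ) + 1 / 2) ^ 2))) *
              ((Real.sqrt ((2 * L m + R m : ℕ) * R m) / R m * 1) ^ 2 / 2 + (Real.sqrt ((2 * L m + R m : ℕ) * R m) / R m * 1) ^ 2 / 2) +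
            (1 + εg⁻¹) * ((P.N j : ℝ) ^ 2 / π ^ 2) * (4 / (((Λb m * G - K m - (L m + R m) : ℕ) : ℝ)) ^ 2 *
              (1 / ((((Λb m * G - K m - (L m + R m) : ℕ) : ℝ)) + ((L m + R m : ℕ) : ℝ)) ^ (2 * po) +
                1 / (P.N j * ((((Λb m * G - K m - (L m + R m) : ℕ) : ℝ)) + ((L m + R m : ℕ) : ℝ)) ^ (2 * po - 1)))) *
              ((2 * ((L m + R m : ℕ) : ℝ) / P.N j + 1) * ((L m + R m : ℕ) : ℝ) ^ (2 * po)) * Φ m) +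
      Real.sqrt ((π * ((Λb (m + 1) * G : ℕ) : ℝ) * ε / P.N j) ^ 2 * Φ m + 8 * M * P.δ j / π * ((Real.sqrt ((2 * L m + R m : ℕ) * R m) / R m * 1) ^ 2 / 2 + (Real.sqrt ((2 * L m + R m : ℕ) * R m) / R m * 1) ^ 2 / 2)) with hu
  set y : ℕ → ℝ := fun m => ∑' k : Fin 2 → ℤ,
    (if (Λb m : ℤ) ≤ |k 0| ∧ |k 0| < (Λb (m + 1) : ℤ) ∧ (L m : ℤ) < |k 1| then (1 : ℝ) else 0) * cb k with hy
  have hu0 : ∀ m, 0 ≤ u m := fun m => add_nonneg (Real.sqrt_nonneg _) (Real.sqrt_nonneg _)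
  have hy0 : ∀ m, 0 ≤ y m := fun m => tsum_nonneg fun k => mul_nonneg (by split_ifs <;> norm_num) (hcb0 k)
  have hblock : ∀ m ∈ Finset.range Mb, ∑ k ∈ W.filter (fun k => (Λb m : ℤ) ≤ |k 0| ∧ |k 0| < (Λb (m + 1) : ℤ)), ca k ≤
      (u m + Real.sqrt (y m)) ^ 2 := fun m hm =>
    sum_block_iterate_hstep_ctg_le P hγ hδ₀ hd hN₀ hρN a b has h0 hb hab j W (hΛ0.trans (hΛb (Nat.zero_le _))) (hR m) (hLR m)
      (hWK m) (hgap m hm) hWsym hp hεg hM hMδ hε (hEm m hm)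
  -- Step 4: ℓ²-Minkowski over the blocks
  have h4 : ∑ m ∈ Finset.range Mb, ∑ k ∈ W.filter (fun k => (Λb m : ℤ) ≤ |k 0| ∧ |k 0| < (Λb (m + 1) : ℤ)), ca k ≤
      (Real.sqrt (∑ m ∈ Finset.range Mb, u m ^ 2) + Real.sqrt (∑ m ∈ Finset.range Mb, y m)) ^ 2 :=
    sum_le_sq_sqrt_add_sqrt (Finset.range Mb) (fun m _ => hu0 m) (fun m _ => hy0 m) hblock
  -- Step 5: the pass-through energies of the blocks add up to at most the feed class
  have h5 : ∑ m ∈ Finset.range Mb, y m ≤ ∑' k : Fin 2 → ℤ, (if Pf k then (1 : ℝ) else 0) * cb k := by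
    have hle : ∀ m, y m ≤ ∑' k : Fin 2 → ℤ, (if (Λb m : ℤ) ≤ |k 0| ∧ |k 0| < (Λb (m + 1) : ℤ) ∧
        ((Λb m : ℤ) ≤ |k 0| ∧ |k 0| < (Λb (m + 1) : ℤ) ∧ (L m : ℤ) < |k 1|) then (1 : ℝ) else 0) * cb k := fun m =>
      (hIb _).tsum_le_tsum (fun k => indicator_mul_le_of_imp (fun h => ⟨h.1, h.2.1, h⟩) (hcb0 k)) (hIb _)
    have hsum := sum_tsum_blocks_le hcbs hcb0 (fun k : Fin 2 → ℤ => |k 0|) hΛz Pf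
      (fun m k => (Λb m : ℤ) ≤ |k 0| ∧ |k 0| < (Λb (m + 1) : ℤ) ∧ (L m : ℤ) < |k 1|)
      (fun m k h => hPf m k h.1 h.2.1 h.2.2) Mb
    refine ((Finset.sum_le_sum fun m _ => hle m).trans hsum).trans ?_
    exact (hIb _).tsum_le_tsum (fun k => indicator_mul_le_of_imp (fun h => h.2) (hcb0 k)) (hIb _)
  -- Step 5': the block junks (Minkowski across the blocks, total fibre energy ½)
  have hNr : (0 : ℝ) < P.N j := by exact_mod_cast N_pos P hN₀ hρN j
  have hτ0 : ∀ m ∈ Finset.range Mb, 0 ≤ (8 * ((Λb m : ℝ) * G - (((L m + R m : ℕ) : ℝ) - 1)) ^ 2 / (((Λb m : ℝ) * G - (((L m + R m : ℕ) : ℝ) - 1)) ^ 2 - (K m : ℝ) ^ 2) ^ 2 +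
                8 * ((K m : ℝ) + 1 / 2) / (P.N j * (((Λb m : ℝ) * G - (((L m + R m : ℕ) : ℝ) - 1)) ^ 2 - ((K m : ℝ) + 1 / 2) ^ 2))) := by
    intro m hm
    have hg := hgap m hm
    have hK : ((K m + (L m + R m) + 1 : ℕ) : ℝ) ≤ ((Λb m * G : ℕ) : ℝ) := by exact_mod_cast hg
    push_cast at hK
    have h1 : 0 < ((Λb m : ℝ) * G - (((L m + R m : ℕ) : ℝ) - 1)) ^ 2 - (K m : ℝ) ^ 2 := by push_cast; nlinarith
    have h2 : 0 < ((Λb m : ℝ) * G - (((L m + R m : ℕ) : ℝ) - 1)) ^ 2 - ((K m : ℝ) + 1 / 2) ^ 2 := by push_cast; nlinarith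
    positivity
  have ha0 : ∀ m ∈ Finset.range Mb, 0 ≤ (1 + εg) * ((P.N j : ℝ) ^ 2 / π ^ 2) *
              (8 * ((Λb m : ℝ) * G - (((L m + R m : ℕ) : ℝ) - 1)) ^ 2 / (((Λb m : ℝ) * G - (((L m + R m : ℕ) : ℝ) - 1)) ^ 2 - (K m : ℝ) ^ 2) ^ 2 +
                8 * ((K m : ℝ) + 1 / 2) / (P.N j * (((Λb m : ℝ) * G - (((L m + R m : ℕ) : ℝ) - 1)) ^ 2 - ((K m : ℝ) + 1 / 2) ^ 2))) *
              ((Real.sqrt ((2 * L m + R m : ℕ) * R m) / R m * 1) ^ 2 / 2 + (Real.sqrt ((2 * L m + R m : ℕ) * R m) / R m * 1) ^ 2 / 2) +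
            (1 + εg⁻¹) * ((P.N j : ℝ) ^ 2 / π ^ 2) * (4 / (((Λb m * G - K m - (L m + R m) : ℕ) : ℝ)) ^ 2 *
              (1 / ((((Λb m * G - K m - (L m + R m) : ℕ) : ℝ)) + ((L m + R m : ℕ) : ℝ)) ^ (2 * po) +
                1 / (P.N j * ((((Λb m * G - K m - (L m + R m) : ℕ) : ℝ)) + ((L m + R m : ℕ) : ℝ)) ^ (2 * po - 1)))) *
              ((2 * ((L m + R m : ℕ) : ℝ) / P.N j + 1) * ((L m + R m : ℕ) : ℝ) ^ (2 * po)) * Φ m := fun m hm => by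
    have := hτ0 m hm; have := hΦ0 m; positivity
  have hb0 : ∀ m ∈ Finset.range Mb, 0 ≤ (π * ((Λb (m + 1) * G : ℕ) : ℝ) * ε / P.N j) ^ 2 * Φ m + 8 * M * P.δ j / π * ((Real.sqrt ((2 * L m + R m : ℕ) * R m) / R m * 1) ^ 2 / 2 + (Real.sqrt ((2 * L m + R m : ℕ) * R m) / R m * 1) ^ 2 / 2) := fun m _ => by
    have := hΦ0 m; have : 0 ≤ M := by linarith
    have := P.δ_pos hδ₀ hd j; positivity
  have h4' : ∑ m ∈ Finset.range Mb, u m ^ 2 ≤ (Real.sqrt (A + βs / 2) + Real.sqrt (ρs / 2 + Z)) ^ 2 := by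
    have hmink := sum_sq_sqrt_add_sqrt_le' (Finset.range Mb) ha0 hb0
    have hSa : ∑ m ∈ Finset.range Mb, ((1 + εg) * ((P.N j : ℝ) ^ 2 / π ^ 2) *
              (8 * ((Λb m : ℝ) * G - (((L m + R m : ℕ) : ℝ) - 1)) ^ 2 / (((Λb m : ℝ) * G - (((L m + R m : ℕ) : ℝ) - 1)) ^ 2 - (K m : ℝ) ^ 2) ^ 2 +
                8 * ((K m : ℝ) + 1 / 2) / (P.N j * (((Λb m : ℝ) * G - (((L m + R m : ℕ) : ℝ) - 1)) ^ 2 - ((K m : ℝ) + 1 / 2) ^ 2))) *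
              ((Real.sqrt ((2 * L m + R m : ℕ) * R m) / R m * 1) ^ 2 / 2 + (Real.sqrt ((2 * L m + R m : ℕ) * R m) / R m * 1) ^ 2 / 2) +
            (1 + εg⁻¹) * ((P.N j : ℝ) ^ 2 / π ^ 2) * (4 / (((Λb m * G - K m - (L m + R m) : ℕ) : ℝ)) ^ 2 *
              (1 / ((((Λb m * G - K m - (L m + R m) : ℕ) : ℝ)) + ((L m + R m : ℕ) : ℝ)) ^ (2 * po) +
                1 / (P.N j * ((((Λb m * G - K m - (L m + R m) : ℕ) : ℝ)) + ((L m + R m : ℕ) : ℝ)) ^ (2 * po - 1)))) *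
              ((2 * ((L m + R m : ℕ) : ℝ) / P.N j + 1) * ((L m + R m : ℕ) : ℝ) ^ (2 * po)) * Φ m) ≤ A + βs / 2 := by
      rw [Finset.sum_add_distrib]
      have h1 : ∑ m ∈ Finset.range Mb, (1 + εg⁻¹) * ((P.N j : ℝ) ^ 2 / π ^ 2) * (4 / (((Λb m * G - K m - (L m + R m) : ℕ) : ℝ)) ^ 2 *
              (1 / ((((Λb m * G - K m - (L m + R m) : ℕ) : ℝ)) + ((L m + R m : ℕ) : ℝ)) ^ (2 * po) +
                1 / (P.N j * ((((Λb m * G - K m - (L m + R m) : ℕ) : ℝ)) + ((L m + R m : ℕ) : ℝ)) ^ (2 * po - 1)))) *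
              ((2 * ((L m + R m : ℕ) : ℝ) / P.N j + 1) * ((L m + R m : ℕ) : ℝ) ^ (2 * po)) * Φ m ≤ βs * (1 / 2) :=
        calc ∑ m ∈ Finset.range Mb, (1 + εg⁻¹) * ((P.N j : ℝ) ^ 2 / π ^ 2) * (4 / (((Λb m * G - K m - (L m + R m) : ℕ) : ℝ)) ^ 2 *
              (1 / ((((Λb m * G - K m - (L m + R m) : ℕ) : ℝ)) + ((L m + R m : ℕ) : ℝ)) ^ (2 * po) +
                1 / (P.N j * ((((Λb m * G - K m - (L m + R m) : ℕ) : ℝ)) + ((L m + R m : ℕ) : ℝ)) ^ (2 * po - 1)))) *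
              ((2 * ((L m + R m : ℕ) : ℝ) / P.N j + 1) * ((L m + R m : ℕ) : ℝ) ^ (2 * po)) * Φ m
            ≤ ∑ m ∈ Finset.range Mb, βs * Φ m := Finset.sum_le_sum fun m hm => mul_le_mul_of_nonneg_right (hβ m hm) (hΦ0 m)
          _ = βs * ∑ m ∈ Finset.range Mb, Φ m := (Finset.mul_sum _ _ _).symm
          _ ≤ βs * (1 / 2) := mul_le_mul_of_nonneg_left hΦsum hβs
      linarith
    have hSb : ∑ m ∈ Finset.range Mb, ((π * ((Λb (m + 1) * G : ℕ) : ℝ) * ε / P.N j) ^ 2 * Φ m + 8 * M * P.δ j / π * ((Real.sqrt ((2 * L m + R m : ℕ) * R m) / R m * 1) ^ 2 / 2 + (Real.sqrt ((2 * L m + R m : ℕ) * R m) / R m * 1) ^ 2 / 2)) ≤ ρs / 2 + Z := by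
      rw [Finset.sum_add_distrib]
      have h1 : ∑ m ∈ Finset.range Mb, (π * ((Λb (m + 1) * G : ℕ) : ℝ) * ε / P.N j) ^ 2 * Φ m ≤ ρs * (1 / 2) :=
        calc ∑ m ∈ Finset.range Mb, (π * ((Λb (m + 1) * G : ℕ) : ℝ) * ε / P.N j) ^ 2 * Φ m
            ≤ ∑ m ∈ Finset.range Mb, ρs * Φ m := Finset.sum_le_sum fun m hm => mul_le_mul_of_nonneg_right (hρ m hm) (hΦ0 m)
          _ = ρs * ∑ m ∈ Finset.range Mb, Φ m := (Finset.mul_sum _ _ _).symm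
          _ ≤ ρs * (1 / 2) := mul_le_mul_of_nonneg_left hΦsum hρs
      linarith
    exact hmink.trans (pow_le_pow_left₀ (add_nonneg (Real.sqrt_nonneg _) (Real.sqrt_nonneg _))
      (add_le_add (Real.sqrt_le_sqrt hSa) (Real.sqrt_le_sqrt hSb)) 2)
  -- Step 6: assemble
  have h6 : ∑ k ∈ W, ca k ≤ (Real.sqrt (A + βs / 2) + Real.sqrt (ρs / 2 + Z) +
      Real.sqrt (∑' k : Fin 2 → ℤ, (if Pf k then (1 : ℝ) else 0) * cb k)) ^ 2 := by
    rw [h2]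
    exact le_add_sq_mono h4 (Real.sqrt_nonneg _) (Real.sqrt_nonneg _)
      ((Real.sqrt_le_sqrt h4').trans_eq (Real.sqrt_sq (add_nonneg (Real.sqrt_nonneg _) (Real.sqrt_nonneg _))))
      (Real.sqrt_le_sqrt h5)
  exact h1.trans (add_le_add h6 hfar)

end Cascade

end Summit.AnomalousDissipation.AnomalousDissipation.Theorems.SawtoothPulseCascade.K1Window
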